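import Mathlib.LinearAlgebra.Matrix.NonsingularInverse
import Mathlib.Analysis.Complex.Polynomial.Basic
import Mathlib.Algebra.BigOperators.Group.Finset.Basic
import HarnessLib

/-!
# ValiantsHypothesis / SymPencil — crux `EquivariantSdcNotQP` (stmt-ValiantsHypothesis-17792), line
# `birth_EquivariantSdcNotQP`, stub `stub_permify`: Schur's normalisation of projective Coxeter
# generators of type `A`

Helper of the item (`--supports stmt-ValiantsHypothesis-17792 --as helper`; 0 definitions, 0 named
facts).  Pure matrix algebra over `ℂ` (Schur 1911, the computation of `M(𝔖_n) = ℤ/2`, `n ≥ 4`, in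
its representation-theoretic form): let `P_0, …, P_{n-2} ∈ M_k(ℂ)`, `k ≥ 1`, satisfy the Coxeter
relations of `𝔖_n` UP TO SCALARS — `P_r² ∈ ℂˣ·1`, `(P_rP_{r+1})³ ∈ ℂ·1`, `(P_rP_t)² ∈ ℂ·1`
(`r + 2 ≤ t`).  Then after rescaling `T_r = a_r P_r` (`a_r ≠ 0`) one has EXACTLY `T_r² = 1`,
`T_rT_{r+1}T_r = T_{r+1}T_rT_{r+1}`, and EITHER all far pairs commute, `T_rT_t = T_tT_r`, OR all
far pairs anticommute, `T_rT_t = -T_tT_r` (**`coxeter_normalization`**).  Steps: square roots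
normalise `T_r² = 1`; then `(T_rT_{r+1})³ = d_r = ±1` (the cube of the inverse `T_{r+1}T_r` is the
same scalar), and the sign recursion `δ_{r+1} = δ_r d_r` kills all `d_r`; `(T_rT_t)² = e_{rt} = ±1`,
and conjugating by `T_tT_{t+1}` (which carries `T_t` to `T_{t+1}` by the braid relation and `T_r` to
`±T_r`) shows `e_{rt} = e_{r,t+1}`, symmetrically in `r`, so `e_{rt} = e_{02}` is constant.

* involution calculus: `invol_mul_cancel_right/left`, `braid_of_cube_eq_one`,
  `sq_eq_one_of_cube_scalar`, `far_scalar_sq_eq_one`, `far_comm_of_sq_scalar`,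
  `far_scalar_eq_of_braid` (the conjugation step);
* **`coxeter_normalization`** (the dichotomy above).

Honest framing: matrix algebra only; `stub_permify`, the crux `SymPencil.EquivariantSdcNotQP` and
`VP ≠ VNP` remain OPEN and nothing here is progress on them.
-/

noncomputable section

set_option linter.dupNamespace false

namespace Summit.ValiantsHypothesis.ValiantsHypothesis.Theorems.SymPencilEquivariantSdcNotQP.SpinDichotomy

open Matrix

variable {k : ℕ}

/-! ## Scalars and involutions in `M_k(ℂ)` -/

/-- The scalar of a scalar matrix is its `(i,i)` entry. [folklore] -/
theorem smul_one_apply_eq {A : Matrix (Fin k) (Fin k) ℂ} {c : ℂ} (i : Fin k)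
    (h : A = c • (1 : Matrix (Fin k) (Fin k) ℂ)) : A i i = c := by
  rw [h, Matrix.smul_apply, one_apply_eq, smul_eq_mul, mul_one]

/-- `c • 1 = d • 1` in `M_k(ℂ)`, `k ≥ 1`, forces `c = d`. [folklore] -/
theorem smul_one_injective (hk : 1 ≤ k) {c d : ℂ}
    (h : c • (1 : Matrix (Fin k) (Fin k) ℂ) = d • (1 : Matrix (Fin k) (Fin k) ℂ)) :
    c = d := by
  have := smul_one_apply_eq (A := c • (1 : Matrix (Fin k) (Fin k) ℂ)) ⟨0, hk⟩ h
  rwa [Matrix.smul_apply, one_apply_eq, smul_eq_mul, mul_one] at this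

/-- Right cancellation of an involution: `X A A = X`. [folklore] -/
theorem invol_mul_cancel_right {A : Matrix (Fin k) (Fin k) ℂ} (hA : A * A = 1)
    (X : Matrix (Fin k) (Fin k) ℂ) : X * A * A = X := by
  rw [Matrix.mul_assoc, hA, Matrix.mul_one]

/-- Left cancellation of an involution: `A (A X) = X`. [folklore] -/
theorem invol_mul_cancel_left {A : Matrix (Fin k) (Fin k) ℂ} (hA : A * A = 1)
    (X : Matrix (Fin k) (Fin k) ℂ) : A * (A * X) = X := by
  rw [← Matrix.mul_assoc, hA, Matrix.one_mul]

/-- Scalars pull out of a square of a product. [folklore] -/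
theorem smul_mul_smul_sq (x y : ℂ) (A B : Matrix (Fin k) (Fin k) ℂ) :
    (x • A) * (y • B) * ((x • A) * (y • B)) = (x * y * (x * y)) • (A * B * (A * B)) := by
  simp only [Matrix.smul_mul, Matrix.mul_smul, smul_smul]
  congr 1
  ring

/-- Scalars pull out of a cube of a product. [folklore] -/
theorem smul_mul_smul_cube (x y : ℂ) (A B : Matrix (Fin k) (Fin k) ℂ) :
    (x • A) * (y • B) * ((x • A) * (y • B)) * ((x • A) * (y • B)) =
      (x * y * (x * y) * (x * y)) • (A * B * (A * B) * (A * B)) := by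
  simp only [Matrix.smul_mul, Matrix.mul_smul, smul_smul]
  congr 1
  ring

/-- **Braid relation from the cube**: involutions `A`, `B` with `(AB)³ = 1` satisfy
`ABA = BAB`. [folklore] -/
theorem braid_of_cube_eq_one {A B : Matrix (Fin k) (Fin k) ℂ} (hA : A * A = 1) (hB : B * B = 1)
    (h3 : A * B * (A * B) * (A * B) = 1) : A * B * A = B * A * B := by
  have h := congrArg (· * (B * A * B)) h3
  simp only [← Matrix.mul_assoc, Matrix.one_mul] at h
  rw [invol_mul_cancel_right hB, invol_mul_cancel_right hA, invol_mul_cancel_right hB] at h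
  exact h

/-- For involutions `A`, `B` with `(AB)³ = d·1` (`k ≥ 1`): `d² = 1` — the inverse `BA = (AB)⁻¹`
has cube `A (AB)³ A = d·1` as well, and `(AB)³ (BA)³ = 1`. [folklore] -/
theorem sq_eq_one_of_cube_scalar (hk : 1 ≤ k) {A B : Matrix (Fin k) (Fin k) ℂ} (hA : A * A = 1)
    (hB : B * B = 1) {d : ℂ}
    (h3 : A * B * (A * B) * (A * B) = d • (1 : Matrix (Fin k) (Fin k) ℂ)) : d * d = 1 := by
  -- the cube of `BA`
  have h3' : B * A * (B * A) * (B * A) = d • (1 : Matrix (Fin k) (Fin k) ℂ) := by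
    have h := congrArg (fun X => A * X * A) h3
    simp only [← Matrix.mul_assoc, hA, Matrix.one_mul, Matrix.mul_smul, Matrix.mul_one,
      Matrix.smul_mul] at h
    simpa only [← Matrix.mul_assoc] using h
  -- `(AB)³ (BA)³ = 1`
  have hprod : (A * B * (A * B) * (A * B)) * (B * A * (B * A) * (B * A)) = 1 := by
    simp only [← Matrix.mul_assoc]
    rw [invol_mul_cancel_right hB, invol_mul_cancel_right hA, invol_mul_cancel_right hB,
      invol_mul_cancel_right hA, invol_mul_cancel_right hB, hA]
  rw [h3, h3', Matrix.smul_mul, Matrix.mul_smul, Matrix.one_mul, smul_smul] at hprod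
  exact smul_one_injective hk (by rw [hprod, one_smul])

/-- For involutions `A`, `B` with `(AB)² = e·1` (`k ≥ 1`): `e² = 1`. [folklore] -/
theorem far_scalar_sq_eq_one (hk : 1 ≤ k) {A B : Matrix (Fin k) (Fin k) ℂ} (hA : A * A = 1)
    (hB : B * B = 1)
    {e : ℂ} (h2 : A * B * (A * B) = e • (1 : Matrix (Fin k) (Fin k) ℂ)) : e * e = 1 := by
  have h2' : B * A * (B * A) = e • (1 : Matrix (Fin k) (Fin k) ℂ) := by
    have h := congrArg (fun X => B * X * B) h2
    simp only [← Matrix.mul_assoc, hB, Matrix.mul_smul, Matrix.mul_one, Matrix.smul_mul] at h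
    rw [invol_mul_cancel_right hB] at h
    simpa only [← Matrix.mul_assoc] using h
  have hprod : (A * B * (A * B)) * (B * A * (B * A)) = 1 := by
    simp only [← Matrix.mul_assoc]
    rw [invol_mul_cancel_right hB, invol_mul_cancel_right hA, invol_mul_cancel_right hB, hA]
  rw [h2, h2', Matrix.smul_mul, Matrix.mul_smul, Matrix.one_mul, smul_smul] at hprod
  exact smul_one_injective hk (by rw [hprod, one_smul])

/-- For involutions `A`, `B` with `(AB)² = e·1`: `AB = e·BA`, `BA = e·AB` and `(BA)² = e·1`
(`k ≥ 1`). [folklore] -/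
theorem far_comm_of_sq_scalar (hk : 1 ≤ k) {A B : Matrix (Fin k) (Fin k) ℂ} (hA : A * A = 1)
    (hB : B * B = 1)
    {e : ℂ} (h2 : A * B * (A * B) = e • (1 : Matrix (Fin k) (Fin k) ℂ)) :
    A * B = e • (B * A) ∧ B * A = e • (A * B) ∧
      B * A * (B * A) = e • (1 : Matrix (Fin k) (Fin k) ℂ) := by
  have hee := far_scalar_sq_eq_one hk hA hB h2
  have h1 : A * B = e • (B * A) := by
    have h := congrArg (· * (B * A)) h2
    simp only [← Matrix.mul_assoc, Matrix.smul_mul, Matrix.one_mul] at h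
    rw [invol_mul_cancel_right hB, invol_mul_cancel_right hA] at h
    exact h
  have h2' : B * A = e • (A * B) := by
    rw [h1, smul_smul, hee, one_smul]
  refine ⟨h1, h2', ?_⟩
  rw [h2', Matrix.smul_mul, Matrix.mul_smul, smul_smul, h2, smul_smul, hee, one_mul]

/-- **The conjugation step.**  Involutions `A`, `B`, `R` with the braid relation `ABA = BAB` and
`(RA)² = e₁·1`, `(RB)² = e₂·1` (`k ≥ 1`) have `e₁ = e₂`: conjugation by `C = AB` carries `A` to `B`
and `R` to `e₁e₂·R`, hence `(RA)²` to `(e₁e₂)²(RB)² = (RB)²`, while it fixes the scalar `(RA)²`.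
[folklore] -/
theorem far_scalar_eq_of_braid (hk : 1 ≤ k) {A B R : Matrix (Fin k) (Fin k) ℂ} (hA : A * A = 1)
    (hB : B * B = 1)
    (hR : R * R = 1) (hbraid : A * B * A = B * A * B) {e₁ e₂ : ℂ}
    (h1 : R * A * (R * A) = e₁ • (1 : Matrix (Fin k) (Fin k) ℂ))
    (h2 : R * B * (R * B) = e₂ • (1 : Matrix (Fin k) (Fin k) ℂ)) : e₁ = e₂ := by
  obtain ⟨hRA, hAR, -⟩ := far_comm_of_sq_scalar hk hR hA h1
  obtain ⟨hRB, hBR, -⟩ := far_comm_of_sq_scalar hk hR hB h2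
  have he1 := far_scalar_sq_eq_one hk hR hA h1
  have he2 := far_scalar_sq_eq_one hk hR hB h2
  -- `C A C' = B` with `C = AB`, `C' = BA`
  have hCA : A * B * A * (B * A) = B := by
    rw [hbraid, Matrix.mul_assoc, ← Matrix.mul_assoc B B, hB, Matrix.one_mul,
      invol_mul_cancel_right hA]
  -- `C R C' = (e₁ e₂) • R`
  have hBRB : B * R * B = e₂ • R := by rw [hBR, Matrix.smul_mul, invol_mul_cancel_right hB]
  have hARA : A * R * A = e₁ • R := by rw [hAR, Matrix.smul_mul, invol_mul_cancel_right hA]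
  have hCR : A * B * R * (B * A) = (e₁ * e₂) • R := by
    calc A * B * R * (B * A) = A * (B * R * B) * A := by simp only [Matrix.mul_assoc]
      _ = (e₁ * e₂) • R := by
        rw [hBRB, Matrix.mul_smul, Matrix.smul_mul, hARA, smul_smul, mul_comm]
  -- conjugate `(RA)² = e₁` by `C`
  have hCC' : A * B * (B * A) = 1 := by rw [Matrix.mul_assoc, invol_mul_cancel_left hB, hA]
  have key : A * B * (R * A * (R * A)) * (B * A) = e₁ • (1 : Matrix (Fin k) (Fin k) ℂ) := by
    rw [h1, Matrix.mul_smul, Matrix.mul_one, Matrix.smul_mul, hCC']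
  have key' : A * B * (R * A * (R * A)) * (B * A) =
      (A * B * R * (B * A)) * (A * B * A * (B * A)) * ((A * B * R * (B * A)) *
        (A * B * A * (B * A))) := by
    simp only [← Matrix.mul_assoc]
    rw [invol_mul_cancel_right hA, invol_mul_cancel_right hB, invol_mul_cancel_right hA,
      invol_mul_cancel_right hB, invol_mul_cancel_right hA, invol_mul_cancel_right hB]
  rw [key', hCA, hCR, Matrix.smul_mul, Matrix.smul_mul, Matrix.mul_smul, smul_smul, h2,
    smul_smul] at key
  have := smul_one_injective hk key
  rw [← this, mul_mul_mul_comm, he1, he2, one_mul, one_mul]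

/-! ## Schur's normalisation -/

/-- **Schur's normalisation of projective Coxeter generators of type `A_{n-1}`** (Schur 1911; the
representation-theoretic content of `M(𝔖_n) = ℤ/2`).  Let `P_0, …, P_{n-2} ∈ M_k(ℂ)`, `k ≥ 1`,
satisfy `P_r² = c_r·1` (`c_r ≠ 0`), `(P_rP_{r+1})³ ∈ ℂ·1` and `(P_rP_t)² ∈ ℂ·1` for `r + 2 ≤ t`.
Then there are scalars `a_r ≠ 0` such that `T_r = a_r P_r` satisfy `T_r² = 1` and the braid
relations `T_rT_{r+1}T_r = T_{r+1}T_rT_{r+1}` exactly, and EITHER `T_rT_t = T_tT_r` for all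
`r + 2 ≤ t` OR `T_rT_t = -T_tT_r` for all `r + 2 ≤ t`. [folklore] -/
theorem coxeter_normalization (hk : 1 ≤ k) {n : ℕ} (P : ℕ → Matrix (Fin k) (Fin k) ℂ)
    (hsq : ∀ r, r + 1 < n → ∃ c : ℂ, c ≠ 0 ∧
      P r * P r = c • (1 : Matrix (Fin k) (Fin k) ℂ))
    (hcube : ∀ r, r + 2 < n → ∃ c : ℂ,
      P r * P (r + 1) * (P r * P (r + 1)) * (P r * P (r + 1)) =
        c • (1 : Matrix (Fin k) (Fin k) ℂ))
    (hfar : ∀ r t, t + 1 < n → r + 2 ≤ t →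
      ∃ c : ℂ, P r * P t * (P r * P t) = c • (1 : Matrix (Fin k) (Fin k) ℂ)) :
    ∃ a : ℕ → ℂ, (∀ r, r + 1 < n → a r ≠ 0) ∧
      (∀ r, r + 1 < n → (a r • P r) * (a r • P r) = 1) ∧
      (∀ r, r + 2 < n → (a r • P r) * (a (r + 1) • P (r + 1)) * (a r • P r) =
        (a (r + 1) • P (r + 1)) * (a r • P r) * (a (r + 1) • P (r + 1))) ∧
      ((∀ r t, t + 1 < n → r + 2 ≤ t →
          (a r • P r) * (a t • P t) = (a t • P t) * (a r • P r)) ∨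
       (∀ r t, t + 1 < n → r + 2 ≤ t →
          (a r • P r) * (a t • P t) = -((a t • P t) * (a r • P r)))) := by
  classical
  /- Step 1: square roots, `T_r = μ_r P_r`, `T_r² = 1`. -/
  have hμex : ∀ r, ∃ μ : ℂ,
      (r + 1 < n → μ ≠ 0 ∧ (μ • P r) * (μ • P r) = 1) := by
    intro r
    by_cases hr : r + 1 < n
    · obtain ⟨c, hc0, hc⟩ := hsq r hr
      obtain ⟨μ, hμ⟩ := IsAlgClosed.exists_pow_nat_eq (c⁻¹) (by norm_num : 0 < 2)
      refine ⟨μ, fun _ => ⟨?_, ?_⟩⟩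
      · intro h0
        rw [h0, zero_pow two_ne_zero] at hμ
        exact inv_ne_zero hc0 hμ.symm
      · rw [Matrix.smul_mul, Matrix.mul_smul, smul_smul, hc, smul_smul, ← pow_two, hμ,
          inv_mul_cancel₀ hc0, one_smul]
    · exact ⟨1, fun h => absurd h hr⟩
  choose μ hμ using hμex
  set T : ℕ → Matrix (Fin k) (Fin k) ℂ := fun r => μ r • P r with hT
  have hTT : ∀ r, r + 1 < n → T r * T r = 1 := fun r hr => (hμ r hr).2
  /- Step 2: the cube scalars `d_r = ±1`. -/
  have hdex : ∀ r, ∃ d : ℂ, d * d = 1 ∧ (r + 2 < n →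
      T r * T (r + 1) * (T r * T (r + 1)) * (T r * T (r + 1)) =
        d • (1 : Matrix (Fin k) (Fin k) ℂ)) := by
    intro r
    by_cases hr : r + 2 < n
    · obtain ⟨c, hc⟩ := hcube r hr
      have h3 : T r * T (r + 1) * (T r * T (r + 1)) * (T r * T (r + 1)) =
          ((μ r * μ (r + 1)) ^ 3 * c) • (1 : Matrix (Fin k) (Fin k) ℂ) := by
        simp only [hT, Matrix.smul_mul, Matrix.mul_smul, smul_smul]
        rw [hc, smul_smul]
        congr 1
        ring
      exact ⟨_, sq_eq_one_of_cube_scalar hk (hTT r (by omega)) (hTT (r + 1) (by omega)) h3,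
        fun _ => h3⟩
    · exact ⟨1, one_mul 1, fun h => absurd h hr⟩
  choose d hdd hd using hdex
  /- Step 3: the sign recursion `δ_r = d_0 ⋯ d_{r-1}`, `T'_r = δ_r T_r = a_r P_r`. -/
  set δ : ℕ → ℂ := fun r => ∏ j ∈ Finset.range r, d j with hδ
  have hδsucc : ∀ r, δ (r + 1) = δ r * d r := fun r => Finset.prod_range_succ _ _
  have hδδ : ∀ r, δ r * δ r = 1 := by
    intro r
    rw [hδ, ← Finset.prod_mul_distrib]
    exact Finset.prod_eq_one fun j _ => hdd j
  have hδne : ∀ r, δ r ≠ 0 := fun r h0 => by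
    have := hδδ r; rw [h0, mul_zero] at this; exact zero_ne_one this
  set a : ℕ → ℂ := fun r => δ r * μ r with ha
  set T' : ℕ → Matrix (Fin k) (Fin k) ℂ := fun r => a r • P r with hT'
  have hT'T : ∀ r, T' r = δ r • T r := fun r => by simp only [hT', hT, ha, smul_smul]
  have hT'T' : ∀ r, r + 1 < n → T' r * T' r = 1 := by
    intro r hr
    rw [hT'T, Matrix.smul_mul, Matrix.mul_smul, smul_smul, hTT r hr, hδδ, one_smul]
  have hbraid : ∀ r, r + 2 < n → T' r * T' (r + 1) * T' r = T' (r + 1) * T' r * T' (r + 1) := by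
    intro r hr
    apply braid_of_cube_eq_one (hT'T' r (by omega)) (hT'T' (r + 1) (by omega))
    rw [hT'T r, hT'T (r + 1), smul_mul_smul_cube, hd r hr, smul_smul, hδsucc]
    have : δ r * (δ r * d r) * (δ r * (δ r * d r)) * (δ r * (δ r * d r)) * d r =
        (δ r * δ r) * (δ r * δ r) * (δ r * δ r) * ((d r * d r) * (d r * d r)) := by ring
    rw [this, hδδ, hdd, one_mul, one_mul, one_mul, one_smul]
  /- Step 4: the far scalars `e_{rt} = ±1`. -/
  have heex : ∀ r t, ∃ e : ℂ, (t + 1 < n → r + 2 ≤ t →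
      T' r * T' t * (T' r * T' t) = e • (1 : Matrix (Fin k) (Fin k) ℂ)) := by
    intro r t
    by_cases h : t + 1 < n ∧ r + 2 ≤ t
    · obtain ⟨c, hc⟩ := hfar r t h.1 h.2
      refine ⟨(a r * a t) ^ 2 * c, fun _ _ => ?_⟩
      simp only [hT', Matrix.smul_mul, Matrix.mul_smul, smul_smul]
      rw [hc, smul_smul]
      congr 1
      ring
    · exact ⟨1, fun h1 h2 => absurd ⟨h1, h2⟩ h⟩
  choose e he using heex
  have hee : ∀ r t, t + 1 < n → r + 2 ≤ t → e r t * e r t = 1 := fun r t ht hrt =>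
    far_scalar_sq_eq_one hk (hT'T' r (by omega)) (hT'T' t ht) (he r t ht hrt)
  have hcomm : ∀ r t, t + 1 < n → r + 2 ≤ t →
      T' r * T' t = e r t • (T' t * T' r) ∧
        T' t * T' r * (T' t * T' r) = e r t • (1 : Matrix (Fin k) (Fin k) ℂ) :=
    fun r t ht hrt =>
      let h := far_comm_of_sq_scalar hk (hT'T' r (by omega)) (hT'T' t ht) (he r t ht hrt)
      ⟨h.1, h.2.2⟩
  -- moving `t`: conjugation by `T'_t T'_{t+1}`
  have hstep_t : ∀ r t, r + 2 ≤ t → t + 2 < n → e r t = e r (t + 1) := fun r t hrt ht =>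
    far_scalar_eq_of_braid hk (hT'T' t (by omega)) (hT'T' (t + 1) (by omega))
      (hT'T' r (by omega)) (hbraid t ht) (he r t (by omega) hrt)
      (he r (t + 1) (by omega) (by omega))
  -- moving `r`: conjugation by `T'_r T'_{r+1}`
  have hstep_r : ∀ r t, r + 3 ≤ t → t + 1 < n → e r t = e (r + 1) t := fun r t hrt ht =>
    far_scalar_eq_of_braid hk (hT'T' r (by omega)) (hT'T' (r + 1) (by omega))
      (hT'T' t ht) (hbraid r (by omega)) (hcomm r t ht (by omega)).2
      (hcomm (r + 1) t ht (by omega)).2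
  have hchain_t : ∀ t, 2 ≤ t → t + 1 < n → e 0 t = e 0 2 := by
    intro t ht
    induction t, ht using Nat.le_induction with
    | base => intro; rfl
    | succ t ht ih => intro htn; rw [← hstep_t 0 t (by omega) (by omega), ih (by omega)]
  have hconst : ∀ r t, t + 1 < n → r + 2 ≤ t → e r t = e 0 2 := by
    intro r
    induction r with
    | zero => intro t ht hrt; exact hchain_t t (by omega) ht
    | succ r ih => intro t ht hrt; rw [← hstep_r r t (by omega) ht, ih t ht (by omega)]
  /- Step 5: the dichotomy. -/
  refine ⟨a, fun r hr => mul_ne_zero (hδne r) (hμ r hr).1, hT'T', hbraid, ?_⟩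
  by_cases hε : e 0 2 = 1
  · left
    intro r t ht hrt
    rw [(hcomm r t ht hrt).1, hconst r t ht hrt, hε, one_smul]
  · right
    intro r t ht hrt
    have h02 := hee r t ht hrt
    rw [hconst r t ht hrt] at h02
    have hε' : e 0 2 = -1 := (mul_self_eq_one_iff.mp h02).resolve_left hε
    rw [(hcomm r t ht hrt).1, hconst r t ht hrt, hε', neg_smul, one_smul]

end Summit.ValiantsHypothesis.ValiantsHypothesis.Theorems.SymPencilEquivariantSdcNotQP.SpinDichotomy

end
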